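import Summits.ResolutionOfSingularities.ResolutionOfSingularities.Theorems.FrobeniusClosingPatchingRelPerfectPointBlowupChartIterate
import Summits.ResolutionOfSingularities.ResolutionOfSingularities.Theorems.FrobeniusClosingPatchingRelPerfectCoreRungSquarePlusLinear
import HarnessLib

/-!
# Crux `PatchingRelPerfect` (stmt-ResolutionOfSingularities-16161), chain w52 — CORE RUNG r1g:
# the blow-up-form open core on `I = 𝔪ᵏ + (z₁, …, z_m)` for ALL `k ≥ 1` — a companion through a
# CHAIN of `k - 1` infinitely near regular centres

[OURS · L1 W5.2 · rung] The open core `stub_atomDimFourBlowup` (`AtomDimFourBlowupAt p`) of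
skeleton v5.1 restricted to the family **`I_k = 𝔪ᵏ + (z₁, …, z_m)`**, `z` part of a regular
system of parameters `x = (z, y)` of the regular local base `S`, for EVERY `k ≥ 1` (rung r1c,
`…CoreRungSquarePlusLinear.lean`, is `k = 2`).  `T = Bl_{I_k} Spec S` has transversal
`A_{k-1}`-singularities along an `(n-2)`-fold over the closed point (for a curve germ `Z = V(z)`,
`n = 2`: the `A_{k-1}` surface singularity `y·w = zᵏ`… in the chart `w = y^k/z`), and the
COMPANION is no longer `𝔪` but the product of the lower members of the family:

  `Q_k = I_1 · I_2 ⋯ I_{k-1}` (`I_1 = 𝔪`),  `Bl_{I_k · Q_k} = Bl_{I_1 I_2 ⋯ I_k} Spec S` REGULAR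

(`coreRung_pow_maximalIdeal_sup_rsopPart`).  The regularity of `Bl_{∏_{j ≤ k} I_j}` is proved by
induction on `k` over ARBITRARY regular rings (`isRegular_of_isBlowup_prod_powSup`): blowing up
`I_1 = (x)` first (Stacks 080A), on the Rees chart of a killed direction `z_j` every `I_l` becomes
the exceptional divisor `(z_j)` (`map_chartBase_powSup_of_mem`), and on the chart of a free
direction `y` one has `I_{l+1} · B = y · I'_l` where `I'_l = (y, e_z)ˡ + (e_z)` is the SAME family
for the quasi-regular sequence `(y, e_{z_1}, …, e_{z_m})` of the chart ring
(`map_chartBase_powSup_of_not_mem`; toolkit `…PointBlowupChartIterate.lean`: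
`isQuasiRegular_cons_chartGen`, `isRegularRing_quot_cons_chartGen`), so after twisting off the
Cartier factor `yᵏ` the induction hypothesis applies on the chart; the charts are assembled by
`isRegular_of_isBlowup_mul_of_charts` (`…PointBlowupChartAssembly.lean`).  Geometrically: blow up
the closed point, then `k - 1` times the intersection of the newest exceptional divisor with the
strict transform of `Y = V(z)`'s… complementary germ — a chain of infinitely near regular centres
`ℙ(T) ⊇ …` ("curvilinear" companion), in every dimension.

Every regular local `S`, every dimension, every `0 ≤ m ≤ dim S`, every `k`; no completeness,
characteristic or residue-field hypothesis; "regular off the closed fibre" automatic (`𝔪ᵏ ⊆ I`).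
In dimension `4` the family contains `(x₁ᵏ, x₂, x₃, x₄)` for all `k` (`m = 3`) — the monomial
complete intersections with one free exponent — and `(x₁,x₂)ᵏ + (x₃, x₄)`, `𝔪ᵏ + (x₄)`.
BC5-type FORMAT evidence for the core; the first rung whose companion is a genuine ITERATED
blow-up (depth `k - 1`).  Nothing here is a statement of the manuscript under review.

## References

* The Stacks Project, Tags 080A, 080B, 0804, 0BIQ. [StacksProject]
* Q. Liu, *Algebraic Geometry and Arithmetic Curves*, OUP 2002, Thm. 8.1.19 (a). [Liu2002]
* U. Görtz, T. Wedhorn, *Algebraic Geometry I* (2nd ed., 2020), Prop. 13.91 (2). [GortzWedhorn2020]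
-/

-- `Summit.<Summit>.<Sub>.Theorems` with `Sub = Summit` (single-conjunct summit, D-0017)
set_option linter.dupNamespace false

noncomputable section

open CategoryTheory CategoryTheory.Limits AlgebraicGeometry Literature.AlgebraicGeometry.Resolution
open scoped Pointwise

namespace Summit.ResolutionOfSingularities.ResolutionOfSingularities.Theorems

universe u

/-- `(g) · (f₁, …, f_a) = (g f₁, …, g f_a)`. [folklore] -/
theorem span_singleton_mul_span_range {A : Type*} [CommSemiring A] (g : A) {ι : Type*}
    (f : ι → A) :
    Ideal.span {g} * Ideal.span (Set.range f) = Ideal.span (Set.range fun k => g * f k) := by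
  apply le_antisymm
  · rw [Ideal.span_mul_span', Ideal.span_le]
    rintro _ ⟨a, ha, b, ⟨k, rfl⟩, rfl⟩
    rw [Set.mem_singleton_iff] at ha
    subst ha
    exact Ideal.subset_span ⟨k, rfl⟩
  · rw [Ideal.span_le]
    rintro _ ⟨k, rfl⟩
    exact Ideal.mul_mem_mul (Ideal.mem_span_singleton_self g) (Ideal.subset_span ⟨k, rfl⟩)

/-! ## The family `F_l(c, J) = (c)ˡ + (c_j : j ∈ J)` on the Rees charts of `Bl_{(c)}` -/

section ChartStep

variable {R : Type u} [CommRing R] {n : ℕ} (c : Fin n → R) (i : Fin n) {a : ℕ}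
  (jJ : Fin a → Fin n)

/-- **Chart of a killed index**: if `i = jJ k₀`, then `((c)^{l+1} + (c ∘ jJ)) · B_i = (c_i)`, the
exceptional divisor. [cite: StacksProject, Tag 0804] -/
theorem map_chartBase_powSup_of_mem (l : ℕ) {k₀ : Fin a} (hk : jJ k₀ = i) :
    (Ideal.span (Set.range c) ^ (l + 1) ⊔ Ideal.span (Set.range (c ∘ jJ))).map (chartBase c i) =
      Ideal.span {chartBase c i (c i)} := by
  have hxi : c i ∈ Ideal.span (Set.range c) := Ideal.mem_span_range_self (f := c) (x := i)
  apply le_antisymm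
  · rw [Ideal.map_sup, Ideal.map_pow, map_reesChartBase_eq (c i) hxi]
    refine sup_le (Ideal.pow_le_self (Nat.succ_ne_zero l)) ?_
    rw [Ideal.map_span, Ideal.span_le]
    rintro _ ⟨_, ⟨k, rfl⟩, rfl⟩
    rw [SetLike.mem_coe, Function.comp_apply, reesChartBase_apply_eq_mul_chartGen c i (jJ k)]
    exact Ideal.mul_mem_right _ _ (Ideal.mem_span_singleton_self _)
  · rw [Ideal.span_singleton_le_iff_mem, ← hk]
    exact Ideal.mem_map_of_mem _ (Ideal.mem_sup_right (Ideal.subset_span ⟨k₀, rfl⟩))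

/-- **Chart of a free index** (valid on every chart, used for `i ∉ J`):
`((c)^{l+1} + (c ∘ jJ)) · B_i = c_i · ((c')ˡ + (c' ∘ succ))` for the chart family
`c' = (c_i, e_{jJ 1}, …, e_{jJ a})` — the same family one level up, twisted by the exceptional
divisor. [cite: StacksProject, Tag 0804] -/
theorem map_chartBase_powSup_of_not_mem (l : ℕ) :
    (Ideal.span (Set.range c) ^ (l + 1) ⊔ Ideal.span (Set.range (c ∘ jJ))).map (chartBase c i) =
      Ideal.span {chartBase c i (c i)} *
        (Ideal.span (Set.range (Fin.cons (chartBase c i (c i)) fun k => chartGen c i (jJ k) :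
            Fin (a + 1) → chartRing c i)) ^ l ⊔
          Ideal.span (Set.range ((Fin.cons (chartBase c i (c i)) fun k => chartGen c i (jJ k) :
            Fin (a + 1) → chartRing c i) ∘ Fin.succ))) := by
  have hxi : c i ∈ Ideal.span (Set.range c) := Ideal.mem_span_range_self (f := c) (x := i)
  -- names
  set g : chartRing c i := chartBase c i (c i) with hg
  set Z' : Ideal (chartRing c i) := Ideal.span (Set.range fun k => chartGen c i (jJ k)) with hZ'
  have hsucc : ((Fin.cons g fun k => chartGen c i (jJ k) : Fin (a + 1) → chartRing c i) ∘ Fin.succ) =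
      fun k => chartGen c i (jJ k) := by
    funext k
    simp only [Function.comp_apply, Fin.cons_succ]
  have hM' : Ideal.span (Set.range (Fin.cons g fun k => chartGen c i (jJ k) :
      Fin (a + 1) → chartRing c i)) = Ideal.span {g} ⊔ Z' := by
    rw [Fin.range_cons, Ideal.span_insert]
  -- `(g) · Z' = (ψ(c ∘ jJ))`
  have hfun : (fun k => g * chartGen c i (jJ k)) = fun k => chartBase c i (c (jJ k)) :=
    funext fun k => (reesChartBase_apply_eq_mul_chartGen c i (jJ k)).symm
  have hgZ : Ideal.span {g} * Z' = Ideal.span (Set.range fun k => chartBase c i (c (jJ k))) := by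
    rw [hZ', span_singleton_mul_span_range, hfun]
  -- the left-hand side
  have hL : (Ideal.span (Set.range c) ^ (l + 1) ⊔ Ideal.span (Set.range (c ∘ jJ))).map
      (chartBase c i) = Ideal.span {g} ^ (l + 1) ⊔
        Ideal.span (Set.range fun k => chartBase c i (c (jJ k))) := by
    rw [Ideal.map_sup, Ideal.map_pow, map_reesChartBase_eq (c i) hxi, Ideal.map_span,
      ← Set.range_comp]
    rfl
  rw [hsucc, hM', hL, ← hZ']
  apply le_antisymm
  · refine sup_le ?_ ?_
    · rw [pow_succ', ]
      exact Ideal.mul_mono_right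
        ((Ideal.pow_right_mono (le_sup_left : Ideal.span {g} ≤ Ideal.span {g} ⊔ Z') l).trans
          le_sup_left)
    · rw [← hgZ]
      exact Ideal.mul_mono_right le_sup_right
  · calc Ideal.span {g} * ((Ideal.span {g} ⊔ Z') ^ l ⊔ Z')
        ≤ Ideal.span {g} * (Ideal.span {g} ^ l ⊔ Z') :=
          Ideal.mul_mono_right (sup_le ((Ideal.sup_pow_le_pow_sup _ _ l)) le_sup_right)
      _ = Ideal.span {g} ^ (l + 1) ⊔ Ideal.span {g} * Z' := by rw [Ideal.mul_sup, ← pow_succ']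
      _ ≤ _ := by rw [hgZ]

end ChartStep

/-! ## `Bl_{F_1 F_2 ⋯ F_k} Spec R` is regular (induction over arbitrary regular rings) -/

/-- **The blow-up of `Spec R` along `∏_{l=1}^{k} ((c)ˡ + (c ∘ jJ))` is regular**, for every regular
ring `R`, quasi-regular `c` with `R/(c)` a regular ring, and injective `jJ` — by induction on `k`:
blow up `(c)` first; on the charts of indices in `J` all factors are the exceptional divisor
(isomorphism); on the other charts the product is `c_iᵏ` times the same product of length `k - 1`
for the chart family `(c_i, e_J)` (quasi-regular with regular quotient, toolkit), to which the
induction hypothesis applies after twisting off the Cartier factor; the charts are assembled by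
`isRegular_of_isBlowup_mul_of_charts`. [cite: StacksProject, Tag 080A] [cite: Liu2002, Thm. 8.1.19 (a)] -/
theorem isRegular_of_isBlowup_prod_powSup (k : ℕ) :
    ∀ (R : Type u) [CommRing R] [IsRegularRing R] {n : ℕ} (c : Fin n → R),
      IsQuasiRegular c → IsRegularRing (R ⧸ Ideal.span (Set.range c)) →
      ∀ {a : ℕ} (jJ : Fin a → Fin n), Function.Injective jJ →
      ∀ (Y : Scheme.{u}) (σ : Y ⟶ Spec (.of R)),
        IsBlowup σ (affineBlowup.idealSheaf (∏ j ∈ Finset.range k,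
          (Ideal.span (Set.range c) ^ (j + 1) ⊔ Ideal.span (Set.range (c ∘ jJ))))) →
        Scheme.IsRegular Y := by
  induction k with
  | zero =>
    intro R _ _ n c hc hq a jJ hjJ Y σ hσ
    rw [Finset.prod_range_zero, Ideal.one_eq_top, affineBlowup.idealSheaf_top] at hσ
    haveI : IsIso σ := hσ.isIso isEffectiveCartier_top
    haveI : IsRegularRing (CommRingCat.of R) := inferInstanceAs (IsRegularRing R)
    exact SectionAscent.TraceIdeal.isRegular_of_iso (asIso σ) (Scheme.isRegular_Spec _)
  | succ k ih =>
    intro R _ _ n c hc hq a jJ hjJ Y σ hσ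
    haveI := hq
    -- split off the first factor `F_1 = (c)`
    have hF1 : Ideal.span (Set.range c) ^ (0 + 1) ⊔ Ideal.span (Set.range (c ∘ jJ)) =
        Ideal.span (Set.range c) := by
      rw [zero_add, pow_one]
      exact sup_eq_left.mpr (Ideal.span_mono (Set.range_comp_subset_range jJ c))
    rw [Finset.prod_range_succ', hF1] at hσ
    refine isRegular_of_isBlowup_mul_of_charts c _ (fun i Y' ρ hρ => ?_) hσ
    haveI : IsRegularRing (chartRing c i) := isRegularRing_blowupChart c i hc
    have hg : chartBase c i (c i) ∈ nonZeroDivisors (chartRing c i) :=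
      reesChartBase_mem_nonZeroDivisors (c i) (Ideal.mem_span_range_self (f := c) (x := i))
    rw [Ideal.map_finsetProd] at hρ
    by_cases hi : ∃ k₀, jJ k₀ = i
    · -- a killed index: everything is the exceptional divisor
      obtain ⟨k₀, hk₀⟩ := hi
      simp_rw [map_chartBase_powSup_of_mem c i jJ _ hk₀] at hρ
      rw [Finset.prod_const, Finset.card_range, Ideal.span_singleton_pow] at hρ
      exact isRegular_of_isBlowup_idealSheaf_span_singleton_of_isRegularRing (pow_mem hg k) hρ
    · -- a free index: twist off `c_iᵏ` and apply the induction hypothesis on the chart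
      have hi' : ∀ k, jJ k ≠ i := fun k h => hi ⟨k, h⟩
      simp_rw [map_chartBase_powSup_of_not_mem c i jJ] at hρ
      rw [Finset.prod_mul_distrib, Finset.prod_const, Finset.card_range,
        Ideal.span_singleton_pow] at hρ
      have hinj : Function.Injective (fun k => (⟨jJ k, hi' k⟩ : {j : Fin n // j ≠ i})) :=
        fun k₁ k₂ h => hjJ (congrArg Subtype.val h)
      have hc' : IsQuasiRegular (Fin.cons (chartBase c i (c i)) fun k => chartGen c i (jJ k) :
          Fin (a + 1) → chartRing c i) :=
        isQuasiRegular_cons_chartGen c i (fun k => ⟨jJ k, hi' k⟩) hc hinj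
      have hq' : IsRegularRing (chartRing c i ⧸ Ideal.span (Set.range
          (Fin.cons (chartBase c i (c i)) fun k => chartGen c i (jJ k) :
            Fin (a + 1) → chartRing c i))) :=
        isRegularRing_quot_cons_chartGen c i (fun k => ⟨jJ k, hi' k⟩) hc
      exact isRegular_of_isBlowup_span_singleton_mul_of_forall (pow_mem hg k) _
        (fun Y'' ρ'' h'' => ih (chartRing c i) _ hc' hq' Fin.succ (Fin.succ_injective _) Y'' ρ'' h'')
        hρ

/-! ## The rung over a regular local base -/

section Rung

variable {S : Type u} [CommRing S] [IsRegularLocalRing S] {m e : ℕ} (x : Fin (m + e) → S)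
  (hx : Ideal.span (Set.range x) = IsLocalRing.maximalIdeal S)
  (hd : (IsLocalRing.maximalIdeal S).spanFinrank = m + e)

include hx hd in
/-- **`Bl_{I_1 ⋯ I_k} Spec S` is regular**, `I_l = 𝔪ˡ + (z₁, …, z_m)`, for `S` regular local with
regular system of parameters `x = (z, y)` (in coordinates). [cite: StacksProject, Tag 080A]
[cite: Liu2002, Thm. 8.1.19 (a)] -/
theorem isRegular_of_isBlowup_prod_pow_maximal_sup (k : ℕ) {Y : Scheme.{u}}
    {σ : Y ⟶ Spec (.of S)}
    (hσ : IsBlowup σ (affineBlowup.idealSheaf (∏ j ∈ Finset.range k,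
      (IsLocalRing.maximalIdeal S ^ (j + 1) ⊔
        Ideal.span (Set.range (x ∘ Fin.castAdd e)))))) :
    Scheme.IsRegular Y := by
  haveI : IsRegularRing S := isRegularRing_of_isRegularLocalRing S
  rw [← hx] at hσ
  exact isRegular_of_isBlowup_prod_powSup k S x (isQuasiRegular_regularSystemOfParameters hd x hx)
    (isRegularRing_quotient_span_rsop x hx) (Fin.castAdd e) (Fin.castAdd_injective _ _) Y σ hσ

end Rung

/-- Some power of `𝔪` lies in `∏_{l=1}^{k} (𝔪ˡ + 𝔞)`. [folklore] -/
theorem exists_pow_maximalIdeal_le_prod {S : Type u} [CommRing S] [IsLocalRing S] (𝔞 : Ideal S)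
    (k : ℕ) : ∃ N : ℕ, IsLocalRing.maximalIdeal S ^ N ≤
      ∏ j ∈ Finset.range k, (IsLocalRing.maximalIdeal S ^ (j + 1) ⊔ 𝔞) := by
  induction k with
  | zero => exact ⟨0, by simp⟩
  | succ k ih =>
    obtain ⟨N, hN⟩ := ih
    refine ⟨N + (k + 1), ?_⟩
    rw [Finset.prod_range_succ, pow_add]
    exact Ideal.mul_mono hN le_sup_left

/-- **`Bl_{I_1 ⋯ I_k} Spec S` is regular** (coordinate-free), `I_l = 𝔪ˡ + (z₁, …, z_m)` with `z` part
of a regular system of parameters. [cite: StacksProject, Tag 080A] [cite: Liu2002, Thm. 8.1.19 (a)] -/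
theorem isRegular_of_isBlowup_prod_pow_maximalIdeal_sup_rsopPart {S : Type u} [CommRing S]
    [IsRegularLocalRing S] {m : ℕ} {z : Fin m → S} (hz : IsRsopPart z) (k : ℕ) {Y : Scheme.{u}}
    {σ : Y ⟶ Spec (.of S)}
    (hσ : IsBlowup σ (affineBlowup.idealSheaf (∏ j ∈ Finset.range k,
      (IsLocalRing.maximalIdeal S ^ (j + 1) ⊔ Ideal.span (Set.range z))))) :
    Scheme.IsRegular Y := by
  obtain ⟨e, x, hd, hx, hxz⟩ := hz.exists_rsop
  have hzx : x ∘ Fin.castAdd e = z := funext hxz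
  rw [← hzx] at hσ
  exact isRegular_of_isBlowup_prod_pow_maximal_sup x hx hd k hσ

/-- **CORE RUNG r1g: the blow-up-form open core on `I = 𝔪ᵏ⁺¹ + (z₁, …, z_m)` for every `k`**, `z`
part of a regular system of parameters of the regular local base `S` (every dimension): every
blow-up `T = Bl_I Spec S` carries a non-zero ideal sheaf cosupported in the closed fibre with
regular blowing up — the companion `Q = ∏_{l=1}^{k} (𝔪ˡ + (z))` works, `Bl_{I·Q} = Bl_{I_1 ⋯ I_{k+1}}`
being regular (a chain of `k` infinitely near regular centres after the point blow-up).  For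
`k = 1` this is rung r1c with `Q = 𝔪`; for `k = 0`, `I = 𝔪` and `Q = 1`.
[cite: StacksProject, Tag 080A] [cite: Liu2002, Thm. 8.1.19 (a)] -/
theorem coreRung_pow_maximalIdeal_sup_rsopPart {S : Type u} [CommRing S] [IsRegularLocalRing S]
    {m : ℕ} {z : Fin m → S} (hz : IsRsopPart z) (k : ℕ)
    (hI : IsLocalRing.maximalIdeal S ^ (k + 1) ⊔ Ideal.span (Set.range z) ≠ ⊥)
    (T : Scheme.{u}) (f : T ⟶ Spec (.of S))
    (hf : IsBlowup f (affineBlowup.idealSheaf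
      (IsLocalRing.maximalIdeal S ^ (k + 1) ⊔ Ideal.span (Set.range z)))) :
    ∃ (J : T.IdealSheafData) (T' : Scheme.{u}) (π : T' ⟶ T), J ≠ ⊥ ∧
      (∀ t : T, t ∈ J.support → f.base t = IsLocalRing.closedPoint S) ∧
      IsBlowup π J ∧ Scheme.IsRegular T' := by
  haveI : IsDomain S := isDomain_of_isRegularLocalRing S
  set I : Ideal S := IsLocalRing.maximalIdeal S ^ (k + 1) ⊔ Ideal.span (Set.range z) with hIdef
  set Q : Ideal S := ∏ j ∈ Finset.range k,
    (IsLocalRing.maximalIdeal S ^ (j + 1) ⊔ Ideal.span (Set.range z)) with hQdef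
  -- `Bl_{I·Q} = Bl_{I_1 ⋯ I_{k+1}}` is regular
  have hIQ : I * Q = ∏ j ∈ Finset.range (k + 1),
      (IsLocalRing.maximalIdeal S ^ (j + 1) ⊔ Ideal.span (Set.range z)) := by
    rw [Finset.prod_range_succ, mul_comm]
  obtain ⟨Y, σ, hσ⟩ := exists_isBlowup (Spec (.of S)) (affineBlowup.idealSheaf (I * Q))
  have hY : Scheme.IsRegular Y := by
    rw [hIQ] at hσ
    exact isRegular_of_isBlowup_prod_pow_maximalIdeal_sup_rsopPart hz (k + 1) hσ
  rw [affineBlowup.idealSheaf_mul] at hσ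
  -- the companion is non-zero and cosupported at the closed point
  obtain ⟨N, hN⟩ := exists_pow_maximalIdeal_le_prod (Ideal.span (Set.range z)) k
  have hle : I ≤ IsLocalRing.maximalIdeal S :=
    sup_le (Ideal.pow_le_self (Nat.succ_ne_zero k)) hz.span_range_le_maximalIdeal
  have h𝔪 : IsLocalRing.maximalIdeal S ≠ ⊥ := fun h => hI (eq_bot_iff.mpr (hle.trans h.le))
  have hQne : Q ≠ ⊥ := fun h => pow_ne_zero N h𝔪 (eq_bot_iff.mpr (hN.trans h.le))
  exact atomConclusion_of_companion_regularLocal hf (affineBlowup.idealSheaf_ne_bot hI)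
    (affineBlowup.idealSheaf_ne_bot hQne) (support_idealSheaf_subset_closedPoint hN) hσ hY

/-- **The registered core's binder shape, restricted to the family** `I = 𝔪ᵏ⁺¹ + (z)` (hypotheses
of `stub_atomDimFourBlowup`; dimension, characteristic, completeness, residue field and the
off-fibre hypothesis unused). [cite: StacksProject, Tag 080A] [cite: Liu2002, Thm. 8.1.19 (a)] -/
theorem atomDimFourBlowupAt_pow_maximalIdeal_sup_rsopPart (p : ℕ) (_hp : p.Prime) (S : Type)
    [CommRing S] [IsRegularLocalRing S] [CharP S p]
    [IsAdicComplete (IsLocalRing.maximalIdeal S) S]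
    [PerfectField (IsLocalRing.ResidueField S)] (_hS : ringKrullDim S = (4 : ℕ))
    {m : ℕ} {z : Fin m → S} (hz : IsRsopPart z) (k : ℕ)
    (hI : IsLocalRing.maximalIdeal S ^ (k + 1) ⊔ Ideal.span (Set.range z) ≠ ⊥)
    (T : Scheme.{0}) (f : T ⟶ Spec (.of S))
    (hf : IsBlowup f (affineBlowup.idealSheaf
      (IsLocalRing.maximalIdeal S ^ (k + 1) ⊔ Ideal.span (Set.range z))))
    (_hoff : ∀ t : T, f.base t ≠ IsLocalRing.closedPoint S →
      IsRegularLocalRing (T.presheaf.stalk t)) :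
    ∃ (J : T.IdealSheafData) (T' : Scheme.{0}) (π : T' ⟶ T), J ≠ ⊥ ∧
      (∀ t : T, t ∈ J.support → f.base t = IsLocalRing.closedPoint S) ∧
      IsBlowup π J ∧ Scheme.IsRegular T' :=
  coreRung_pow_maximalIdeal_sup_rsopPart hz k hI T f hf

end Summit.ResolutionOfSingularities.ResolutionOfSingularities.Theorems

end
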